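import Mathlib
import HarnessLib
import Summits.HubbardSuperconductivity.HubbardSuperconductivity.Theorems.KLProgrammeC4aPPKernelFirstOrderRows

/-!
# Route `KLProgramme` — crux C4a, S3 brick (B4) «(U1)-HYBRID» kernel side, B-1 (vi): THE SIX KERNEL ROWS ARE CLOSED UNDER CONTRACTIVE LINEAR COMBINATIONS
# (`a·Kr₁ + b·Kr₂`, `|a| + |b| ≤ 1`) — differences of two cutoff kernels, the three-piece partition re-summed, the model window `P − R_M`, all by one lemma

Cell `gate-hubbard-kl`, seat hubbard-kl-k3c3-p1 (g19; row «δμ-flow with klAngularMean constant piece»).  Companion of `…C4aPPKernelFirstOrderRows` (the six rows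
`hKd hKc hK0 hK0s hK1 hKs1` of k3c3-p3's B-1 (vi) `firstOrderLayer_abs_le` for `P/C`, `A_s/C`, `M_s/C`).

WHY.  The (C)-closer's identification of B-1 (vi)'s kernel `Kr` with the model's partner propagator structure ((B3): slice differences of cutoff kernels, the finite
Matsubara window, the smooth partition `P = A_s + swap A_s + M_s`) produces LINEAR COMBINATIONS of kernels for which the rows are already landed.  The six rows are
homogeneous of degree one in `Kr` and sub-additive, so for kernels `Kr₁, Kr₂` that are differentiable in the partner level at EVERY loop level (true for `P`, `A_s`,
`M_s`: `contDiff_one_ppTrueKernel`, `contDiff_two_ppFarKernelS_u`, `contDiff_two_ppMidKernelS_u`) and satisfy the six rows, every `a·Kr₁ + b·Kr₂` with `|a| + |b| ≤ 1`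
satisfies them again (**`firstOrderRows_lincomb`**); the one-kernel rescaling `a·Kr₁`, `|a| ≤ 1`, is the case `b = 0` (**`firstOrderRows_smul`**).  Example of record:
two true kernels at cutoffs `Λ₁, Λ₂ ≥ lo` with the level box inside `K` shells of both ⇒ `(P^{Λ₁} − P^{Λ₂})/(2C_P)` satisfies the rows (**`ppTrueKernel_sliceDiff_firstOrderRows`**).
Pure real analysis; nothing asserts (C), K3, the window or superconductivity.
References: BGM 2006 §2.4 (2.36) [cite: BenfattoGiulianiMastropietro2006]; FST II CPAM 51 (1998) §3 [cite: FeldmanSalmhoferTrubowitz1998].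
-/

noncomputable section

namespace Summit.HubbardSuperconductivity.HubbardSuperconductivity.Theorems.C4a

set_option linter.dupNamespace false -- summit = problem name (single-conjunct summit), D-0017

open Real Set MeasureTheory
open Literature.MathematicalPhysics.QuantumLattice Literature.Analysis.SpecialFunctions

set_option maxHeartbeats 400000 in
/-- **THE SIX ROWS OF B-1 (vi) ARE CLOSED UNDER CONTRACTIVE LINEAR COMBINATIONS**: if `Kr₁`, `Kr₂` are differentiable in the partner level at every loop level and
satisfy `hKd hKc hK0 hK0s hK1 hKs1` (floor `lo`, box `hi`), then so does `fun e u => a·Kr₁ e u + b·Kr₂ e u` whenever `|a| + |b| ≤ 1`. [folklore] -/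
theorem firstOrderRows_lincomb {Kr₁ Kr₂ : ℝ → ℝ → ℝ} {lo hi a b : ℝ} (hab : |a| + |b| ≤ 1)
    (hD₁ : ∀ e, Differentiable ℝ (Kr₁ e)) (hD₂ : ∀ e, Differentiable ℝ (Kr₂ e))
    (hKd₁ : ∀ e ∈ Icc (-hi) hi, ContDiff ℝ 1 (Kr₁ e)) (hKc₁ : Continuous fun p : ℝ × ℝ => deriv (Kr₁ p.1) p.2)
    (hK0₁ : ∀ e ∈ Icc (-hi) hi, e ≠ 0 → ∀ u, |Kr₁ e u| ≤ (max |e| |u|)⁻¹) (hK0s₁ : ∀ e ∈ Icc (-lo) lo, ∀ u, |Kr₁ e u| ≤ (max lo |u|)⁻¹)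
    (hK1₁ : ∀ e ∈ Icc (-hi) hi, e ≠ 0 → ∀ u, |deriv (Kr₁ e) u| ≤ (max |e| |u|)⁻¹ ^ 2)
    (hKs1₁ : ∀ e ∈ Icc (-lo) lo, ∀ u, |deriv (Kr₁ e) u| ≤ (max lo |u|)⁻¹ ^ 2)
    (hKd₂ : ∀ e ∈ Icc (-hi) hi, ContDiff ℝ 1 (Kr₂ e)) (hKc₂ : Continuous fun p : ℝ × ℝ => deriv (Kr₂ p.1) p.2)
    (hK0₂ : ∀ e ∈ Icc (-hi) hi, e ≠ 0 → ∀ u, |Kr₂ e u| ≤ (max |e| |u|)⁻¹) (hK0s₂ : ∀ e ∈ Icc (-lo) lo, ∀ u, |Kr₂ e u| ≤ (max lo |u|)⁻¹)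
    (hK1₂ : ∀ e ∈ Icc (-hi) hi, e ≠ 0 → ∀ u, |deriv (Kr₂ e) u| ≤ (max |e| |u|)⁻¹ ^ 2)
    (hKs1₂ : ∀ e ∈ Icc (-lo) lo, ∀ u, |deriv (Kr₂ e) u| ≤ (max lo |u|)⁻¹ ^ 2) :
    (∀ e ∈ Icc (-hi) hi, ContDiff ℝ 1 (fun u : ℝ => a * Kr₁ e u + b * Kr₂ e u)) ∧
    (Continuous fun p : ℝ × ℝ => deriv (fun u : ℝ => a * Kr₁ p.1 u + b * Kr₂ p.1 u) p.2) ∧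
    (∀ e ∈ Icc (-hi) hi, e ≠ 0 → ∀ u, |a * Kr₁ e u + b * Kr₂ e u| ≤ (max |e| |u|)⁻¹) ∧
    (∀ e ∈ Icc (-lo) lo, ∀ u, |a * Kr₁ e u + b * Kr₂ e u| ≤ (max lo |u|)⁻¹) ∧
    (∀ e ∈ Icc (-hi) hi, e ≠ 0 → ∀ u, |deriv (fun u : ℝ => a * Kr₁ e u + b * Kr₂ e u) u| ≤ (max |e| |u|)⁻¹ ^ 2) ∧
    (∀ e ∈ Icc (-lo) lo, ∀ u, |deriv (fun u : ℝ => a * Kr₁ e u + b * Kr₂ e u) u| ≤ (max lo |u|)⁻¹ ^ 2) := by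
  have ha : 0 ≤ |a| := abs_nonneg a
  have hb : 0 ≤ |b| := abs_nonneg b
  -- the derivative of the combination, at every loop level
  have hd : ∀ e u, deriv (fun u : ℝ => a * Kr₁ e u + b * Kr₂ e u) u = a * deriv (Kr₁ e) u + b * deriv (Kr₂ e) u := fun e u => by
    have h1 := ((hD₁ e u).hasDerivAt).const_mul a
    have h2 := ((hD₂ e u).hasDerivAt).const_mul b
    exact (h1.add h2).deriv
  -- the generic contraction step: `|x| ≤ q`, `|y| ≤ q` ⟹ `|a x + b y| ≤ q`
  have hcomb : ∀ {x y q : ℝ}, |x| ≤ q → |y| ≤ q → |a * x + b * y| ≤ q := fun {x y q} hx hy => by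
    have hq : 0 ≤ q := (abs_nonneg _).trans hx
    calc |a * x + b * y| ≤ |a * x| + |b * y| := abs_add_le _ _
      _ = |a| * |x| + |b| * |y| := by rw [abs_mul, abs_mul]
      _ ≤ |a| * q + |b| * q := add_le_add (mul_le_mul_of_nonneg_left hx ha) (mul_le_mul_of_nonneg_left hy hb)
      _ = (|a| + |b|) * q := by ring
      _ ≤ 1 * q := mul_le_mul_of_nonneg_right hab hq
      _ = q := one_mul q
  refine ⟨fun e he => (contDiff_const.mul (hKd₁ e he)).add (contDiff_const.mul (hKd₂ e he)), ?_,
    fun e he hne u => hcomb (hK0₁ e he hne u) (hK0₂ e he hne u), fun e he u => hcomb (hK0s₁ e he u) (hK0s₂ e he u),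
    fun e he hne u => ?_, fun e he u => ?_⟩
  · have h : (fun p : ℝ × ℝ => deriv (fun u : ℝ => a * Kr₁ p.1 u + b * Kr₂ p.1 u) p.2) =
        fun p => a * deriv (Kr₁ p.1) p.2 + b * deriv (Kr₂ p.1) p.2 := funext fun p => hd p.1 p.2
    rw [h]
    exact (continuous_const.mul hKc₁).add (continuous_const.mul hKc₂)
  · rw [hd]; exact hcomb (hK1₁ e he hne u) (hK1₂ e he hne u)
  · rw [hd]; exact hcomb (hKs1₁ e he u) (hKs1₂ e he u)

/-- **RESCALING**: the six rows for `Kr₁` pass to `fun e u => a·Kr₁ e u` for `|a| ≤ 1` (the case `b = 0` of `firstOrderRows_lincomb`). [folklore] -/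
theorem firstOrderRows_smul {Kr₁ : ℝ → ℝ → ℝ} {lo hi a : ℝ} (ha : |a| ≤ 1) (hD₁ : ∀ e, Differentiable ℝ (Kr₁ e))
    (hKd₁ : ∀ e ∈ Icc (-hi) hi, ContDiff ℝ 1 (Kr₁ e)) (hKc₁ : Continuous fun p : ℝ × ℝ => deriv (Kr₁ p.1) p.2)
    (hK0₁ : ∀ e ∈ Icc (-hi) hi, e ≠ 0 → ∀ u, |Kr₁ e u| ≤ (max |e| |u|)⁻¹) (hK0s₁ : ∀ e ∈ Icc (-lo) lo, ∀ u, |Kr₁ e u| ≤ (max lo |u|)⁻¹)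
    (hK1₁ : ∀ e ∈ Icc (-hi) hi, e ≠ 0 → ∀ u, |deriv (Kr₁ e) u| ≤ (max |e| |u|)⁻¹ ^ 2)
    (hKs1₁ : ∀ e ∈ Icc (-lo) lo, ∀ u, |deriv (Kr₁ e) u| ≤ (max lo |u|)⁻¹ ^ 2) :
    (∀ e ∈ Icc (-hi) hi, ContDiff ℝ 1 (fun u : ℝ => a * Kr₁ e u)) ∧
    (Continuous fun p : ℝ × ℝ => deriv (fun u : ℝ => a * Kr₁ p.1 u) p.2) ∧
    (∀ e ∈ Icc (-hi) hi, e ≠ 0 → ∀ u, |a * Kr₁ e u| ≤ (max |e| |u|)⁻¹) ∧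
    (∀ e ∈ Icc (-lo) lo, ∀ u, |a * Kr₁ e u| ≤ (max lo |u|)⁻¹) ∧
    (∀ e ∈ Icc (-hi) hi, e ≠ 0 → ∀ u, |deriv (fun u : ℝ => a * Kr₁ e u) u| ≤ (max |e| |u|)⁻¹ ^ 2) ∧
    (∀ e ∈ Icc (-lo) lo, ∀ u, |deriv (fun u : ℝ => a * Kr₁ e u) u| ≤ (max lo |u|)⁻¹ ^ 2) := by
  have hab : |a| + |(0 : ℝ)| ≤ 1 := by rw [abs_zero, add_zero]; exact ha
  obtain ⟨h1, h2, h3, h4, h5, h6⟩ := firstOrderRows_lincomb (Kr₂ := fun _ _ => (0 : ℝ)) (lo := lo) (hi := hi) hab hD₁ (fun _ => differentiable_const 0)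
    hKd₁ hKc₁ hK0₁ hK0s₁ hK1₁ hKs1₁ (fun _ _ => contDiff_const) (by simp only [deriv_const']; exact continuous_const)
    (fun e _ _ u => by rw [abs_zero]; positivity) (fun e _ u => by rw [abs_zero]; positivity)
    (fun e _ _ u => by rw [deriv_const, abs_zero]; positivity) (fun e _ u => by rw [deriv_const, abs_zero]; positivity)
  simp only [mul_zero, add_zero] at h1 h2 h3 h4 h5 h6
  exact ⟨h1, h2, h3, h4, h5, h6⟩

set_option maxHeartbeats 400000 in
/-- **EXAMPLE OF RECORD — THE SLICE DIFFERENCE OF TWO TRUE KERNELS**: for cutoffs `lo ≤ Λ₁, Λ₂` with the level box inside `K` shells of both (`hi ≤ K·Λ₁`, `hi ≤ K·Λ₂`,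
`1 ≤ K`), the kernel `(P^{Λ₁} − P^{Λ₂})/(2·C_P)`, `C_P = (12B₁+9) + (64B₂+120B₁+158+(12B₁+5)K) + (128B₁+72)`, satisfies the six rows of B-1 (vi)
(`ppTrueKernel_firstOrderRows_concrete` twice + `firstOrderRows_lincomb` with `a = 1/2`, `b = −1/2`). [cite: BenfattoGiulianiMastropietro2006, §2.4 (2.36)] -/
theorem ppTrueKernel_sliceDiff_firstOrderRows {β Λ₁ Λ₂ : ℝ} (hβ : 0 < β) (hΛ₁ : 0 < Λ₁) (hΛ₂ : 0 < Λ₂) {B₁ B₂ : ℝ} (hB₁ : ∀ x, |deriv salmhoferCutoff x| ≤ B₁)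
    (hB₂ : ∀ x, |deriv (deriv salmhoferCutoff) x| ≤ B₂) {lo hi K : ℝ} (hlo : 0 < lo) (hloΛ₁ : lo ≤ Λ₁) (hloΛ₂ : lo ≤ Λ₂) (hK : 1 ≤ K) (hhiK₁ : hi ≤ K * Λ₁)
    (hhiK₂ : hi ≤ K * Λ₂) :
    (∀ e ∈ Icc (-hi) hi, ContDiff ℝ 1 (fun u : ℝ =>
      1 / 2 * (ppTrueKernel β Λ₁ e u / (12 * B₁ + 9 + (64 * B₂ + 120 * B₁ + 158 + (12 * B₁ + 5) * K) + (128 * B₁ + 72))) +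
      (-(1 / 2)) * (ppTrueKernel β Λ₂ e u / (12 * B₁ + 9 + (64 * B₂ + 120 * B₁ + 158 + (12 * B₁ + 5) * K) + (128 * B₁ + 72))))) ∧
    (Continuous fun p : ℝ × ℝ => deriv (fun u : ℝ =>
      1 / 2 * (ppTrueKernel β Λ₁ p.1 u / (12 * B₁ + 9 + (64 * B₂ + 120 * B₁ + 158 + (12 * B₁ + 5) * K) + (128 * B₁ + 72))) +
      (-(1 / 2)) * (ppTrueKernel β Λ₂ p.1 u / (12 * B₁ + 9 + (64 * B₂ + 120 * B₁ + 158 + (12 * B₁ + 5) * K) + (128 * B₁ + 72)))) p.2) ∧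
    (∀ e ∈ Icc (-hi) hi, e ≠ 0 → ∀ u,
      |1 / 2 * (ppTrueKernel β Λ₁ e u / (12 * B₁ + 9 + (64 * B₂ + 120 * B₁ + 158 + (12 * B₁ + 5) * K) + (128 * B₁ + 72))) +
      (-(1 / 2)) * (ppTrueKernel β Λ₂ e u / (12 * B₁ + 9 + (64 * B₂ + 120 * B₁ + 158 + (12 * B₁ + 5) * K) + (128 * B₁ + 72)))| ≤ (max |e| |u|)⁻¹) ∧
    (∀ e ∈ Icc (-lo) lo, ∀ u,
      |1 / 2 * (ppTrueKernel β Λ₁ e u / (12 * B₁ + 9 + (64 * B₂ + 120 * B₁ + 158 + (12 * B₁ + 5) * K) + (128 * B₁ + 72))) +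
      (-(1 / 2)) * (ppTrueKernel β Λ₂ e u / (12 * B₁ + 9 + (64 * B₂ + 120 * B₁ + 158 + (12 * B₁ + 5) * K) + (128 * B₁ + 72)))| ≤ (max lo |u|)⁻¹) ∧
    (∀ e ∈ Icc (-hi) hi, e ≠ 0 → ∀ u, |deriv (fun u : ℝ =>
      1 / 2 * (ppTrueKernel β Λ₁ e u / (12 * B₁ + 9 + (64 * B₂ + 120 * B₁ + 158 + (12 * B₁ + 5) * K) + (128 * B₁ + 72))) +
      (-(1 / 2)) * (ppTrueKernel β Λ₂ e u / (12 * B₁ + 9 + (64 * B₂ + 120 * B₁ + 158 + (12 * B₁ + 5) * K) + (128 * B₁ + 72)))) u| ≤ (max |e| |u|)⁻¹ ^ 2) ∧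
    (∀ e ∈ Icc (-lo) lo, ∀ u, |deriv (fun u : ℝ =>
      1 / 2 * (ppTrueKernel β Λ₁ e u / (12 * B₁ + 9 + (64 * B₂ + 120 * B₁ + 158 + (12 * B₁ + 5) * K) + (128 * B₁ + 72))) +
      (-(1 / 2)) * (ppTrueKernel β Λ₂ e u / (12 * B₁ + 9 + (64 * B₂ + 120 * B₁ + 158 + (12 * B₁ + 5) * K) + (128 * B₁ + 72)))) u| ≤ (max lo |u|)⁻¹ ^ 2) := by
  have hab : |(1 / 2 : ℝ)| + |(-(1 / 2) : ℝ)| ≤ 1 := by norm_num [abs_of_pos, abs_neg]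
  obtain ⟨a1, a2, a3, a4, a5, a6⟩ := ppTrueKernel_firstOrderRows_concrete (hi := hi) hβ hΛ₁ hB₁ hB₂ hlo hloΛ₁ hK hhiK₁
  obtain ⟨b1, b2, b3, b4, b5, b6⟩ := ppTrueKernel_firstOrderRows_concrete (hi := hi) hβ hΛ₂ hB₁ hB₂ hlo hloΛ₂ hK hhiK₂
  have hD : ∀ {Λ : ℝ}, 0 < Λ → ∀ e, Differentiable ℝ (fun u : ℝ => ppTrueKernel β Λ e u /
      (12 * B₁ + 9 + (64 * B₂ + 120 * B₁ + 158 + (12 * B₁ + 5) * K) + (128 * B₁ + 72))) := fun {Λ} hΛ e =>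
    ((contDiff_one_ppTrueKernel hβ hΛ hB₁ e).div_const _).differentiable one_ne_zero
  exact firstOrderRows_lincomb (Kr₁ := fun e u => ppTrueKernel β Λ₁ e u /
      (12 * B₁ + 9 + (64 * B₂ + 120 * B₁ + 158 + (12 * B₁ + 5) * K) + (128 * B₁ + 72)))
    (Kr₂ := fun e u => ppTrueKernel β Λ₂ e u / (12 * B₁ + 9 + (64 * B₂ + 120 * B₁ + 158 + (12 * B₁ + 5) * K) + (128 * B₁ + 72)))
    hab (hD hΛ₁) (hD hΛ₂) a1 a2 a3 a4 a5 a6 b1 b2 b3 b4 b5 b6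

end Summit.HubbardSuperconductivity.HubbardSuperconductivity.Theorems.C4a

end
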